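import Literature.MathematicalPhysics.QuantumFieldTheory.Balaban1983to89.B11Thm1ExistsUniqueInductionG

/-!
# `Balaban1983to89.B11Thm1ExistsUniqueInductionGBridges` — [Balaban1985Variational] = «[15]», Theorem 1 p. 279 (existence ∕ uniqueness half): PRINT'S INDUCTION ON THE LENGTH, PROVED —
# the truncation lemmas for `B11Thm1ExistsUniqueInductionG.truncSeq` and ★★★ the (E∕U) name `B11Thm1ExistsUniqueCoP7MG.VariationalThm1EUSep{Top,CoP}7MG` from the one-length step token,
# K0's (R)-name, the supply token at length 1 and the lift token (THEOREMS ONLY; the sibling token module stays statement-only)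

Honest framing: statement-level skeleton of published theorems with citation tags; proofs where landed; nothing here is a claim about the Yang–Mills mass gap.  Cell `pub-ymgap`
(HUMAN RULINGS D-0062 ∕ D-0149), lane `pub-ymgap-dag-n12-c` g33 (R134 seat (a), N12 = [B15], s1); `--kind proof --supports` K1⁹ `stmt-QuantumFields-27364`; count-neutral; N12 NOT
discharged; finite 𝕋⁴ at fixed ε; nothing continuum ∕ ℝ⁴ ∕ OS ∕ mass-gap ∕ Clay.  THEOREMS ONLY (0 `def`, 0 `instance`, 0 `sorry`).

THE PRINT ([15] pp. 279–280).  *«Theorem 1 will be proved by induction with respect to k. … We start a proof of Theorem 1 for some k assuming that it is true for k − 1 … We can easily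
construct a configuration V₀ on 𝔅′_{k−1} such that it satisfies (7) on 𝔅′_{k−1} … (11) … we apply the Theorem 1 for k − 1 and the configuration V₀. We get a minimal configuration U₀ =
U_{k−1}(V₀) … (12) From the conditions (11), and from the form (2) of the regularity conditions, it follows that U₀ ∈ U_k({Ω_j}, B₃L³ε₁) ∩ 𝔘_k(𝔅_k, V), (13)»*; then (14) and the
one-length analysis (Prop. 2 + Sects. B–E).  Here: the induction hypothesis = the (E∕U) name at the truncated index; (12)'s regularity = K0's (R)-name there; (11) + (13) = the lift
token; the one-length analysis = the step token; `k = 1` = the supply token under the guard `Adm ∧ (k = 1)`.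

CONTENTS.
* §1 `truncSeq_Ω_of_le` (`= s.Ω j`, `j ≤ k`), `truncSeq_Λ_of_le`, `truncSeq_Ω_of_lt` (`= ∅`, `k < j`), `seqSeparated_truncSeq` ([6] (1.3)–(1.6) inherited), `floorGuard_truncSeq`
  (K0's floor guard is truncation-stable).
* §2 ★★★ `variationalThm1EUSepTop7MG_of_step_of_reg_of_base_of_lift` ∕ ★★★ `…CoP7MG…` ∕ `…CoP7MG_floorGuard…` — the induction (proof = print's: `induction k`; at `k+1 ≥ 2` the lift
  supplies `(ε₀′, δ′, V₀)`, the induction hypothesis a minimiser of the truncated problem, (R) its regularity, the lift (13) = (14) at length `k+1`, the step token concludes; at length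
  `1` the supply token and the step token).  ONE `C₁` shared by step and lift (print's `L³`; RR-2 READ-634 NOTE-b: inhabit at `C₁ := (F.L)^3` with THAT `C₁`'s ceilings).

HONEST SCOPE.  A by-name induction between NAMED `Prop`s none of which is asserted or produced in the tree; nothing of Bałaban's analysis asserted; count-neutral; K0⁷ ∕ K1⁹ NOT closed;
N12 NOT discharged; the YM mass gap (Clay) is NOT proved by any of this.
-/

noncomputable section

namespace Literature.MathematicalPhysics.QuantumFieldTheory.Balaban1983to89.B11Thm1ExistsUniqueInductionG

open T4Continuum B15DeterminingSets GaugeField Node00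
open B16Sect1Backgrounds (toMS)
open B14.Eq218Concrete (Seq)
open B11Thm1ExistsUniqueCoP7MG (VariationalThm1EUSepTop7MG VariationalThm1EUSepCoP7MG)
open B11Thm1ExistsUniqueStepTokensG (ApproxMinTop VariationalThm1EUStepTop7MG VariationalThm1EUStepCoP7MG ApproxMinimiserExistsTop7MG ApproxMinimiserExistsCoP7MG)

/-! ## §1  Truncation lemmas -/

section Trunc

variable {α : Type*} {D : ℕ → Set (Set α)} {k : ℕ}

/-- On the window `j ≤ k` the truncated index has the SAME domains `Ω_j` (at `j = 0` both vanish by the normalisation). [cite: Balaban1985Variational, (11) p.279; Balaban1988Convergent, (2.1) p.254] -/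
theorem truncSeq_Ω_of_le (s : Seq D (k + 1)) {j : ℕ} (hj : j ≤ k) : (truncSeq s).Ω j = s.Ω j := by
  by_cases h1 : 1 ≤ j
  · exact Seq.ofChain_Ω _ h1 hj
  · have hs : s.Ω j = ∅ := s.Ω_off j fun h => h1 h.1
    have ht : (truncSeq s).Ω j = ∅ := (truncSeq s).Ω_off j fun h => h1 h.1
    rw [hs, ht]

/-- On the window `j ≤ k` the truncated index has the same domains `Λ_j`. [cite: Balaban1985Variational, (11) p.279; Balaban1988Convergent, (2.1) p.254] -/
theorem truncSeq_Λ_of_le (s : Seq D (k + 1)) {j : ℕ} (hj : j ≤ k) : (truncSeq s).Λ j = s.Λ j := by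
  by_cases h1 : 1 ≤ j
  · exact Seq.ofChain_Λ _ h1 hj
  · have hs : s.Λ j = ∅ := s.Λ_off j fun h => h1 h.1
    have ht : (truncSeq s).Λ j = ∅ := (truncSeq s).Λ_off j fun h => h1 h.1
    rw [hs, ht]

/-- Above the window the truncated index is empty: the last domain `Ω_{k+1}` is DROPPED. [cite: Balaban1985Variational, (11) p.279; Balaban1988Convergent, (2.18) p.257] -/
theorem truncSeq_Ω_of_lt (s : Seq D (k + 1)) {j : ℕ} (hj : k < j) : (truncSeq s).Ω j = ∅ :=
  (truncSeq s).Ω_off j fun h => absurd h.2 (not_le.mpr hj)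

end Trunc

section TruncRecord

variable {F : T4Family}

/-- Separation ([6] (1.3)–(1.6)) is INHERITED by the truncated index. [cite: Balaban1985RegularSpaces, (1.3)–(1.6) p.77; Balaban1985Variational, (11) p.279] -/
theorem seqSeparated_truncSeq {ν : Stage7Numerics} {M : ℕ} {g : ℕ → ℝ} {K k : ℕ} {M₁ : ℕ} (s : SeqOfRecord F ν M g K (k + 1))
    (hsep : Sect2.SeqSeparated M₁ s) : Sect2.SeqSeparated M₁ (truncSeq s) := by
  intro n h1 hn
  rw [truncSeq_Ω_of_le s (Nat.succ_le_of_lt hn), truncSeq_Ω_of_le s hn.le]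
  exact hsep n h1 (Nat.lt_succ_of_lt hn)

/-- K0's floor guard `c ≤ ν.M₁` is truncation-stable (it does not read the index). [cite: Balaban1985RegularSpaces, (1.3)–(1.6) p.77 (bookkeeping)] -/
theorem floorGuard_truncSeq (c : ℕ) (ν : Stage7Numerics) (M : ℕ) (g : ℕ → ℝ) (K k : ℕ) (s : SeqOfRecord F ν M g K (k + 1))
    (h : floorGuard F c ν M g K (k + 1) s) : floorGuard F c ν M g K k (truncSeq s) := h

end TruncRecord

/-! ## §2  Print's induction, proved -/

section Induction

variable {F : T4Family} {N : ℕ} [NeZero N]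
variable {Sup : (ν : Stage7Numerics) → (K : ℕ) → (ℕ → Set (Site (F.P K) 0)) → Set (Site (F.P K) 0)} {Adm : StepGuard F} {C₁ B₃ a₀ a₁ : ℝ}

/-- **★★★ [15] THEOREM 1 (E∕U) BY INDUCTION ON THE LENGTH — print's proof architecture, kernel-checked**: the guard-generic (E∕U) named fact `VariationalThm1EUSepTop7MG F N Sup Adm B₃
a₀ a₁` follows from (i) the ONE-LENGTH STEP token ([15] Prop. 2 + Sects. B–E given an approximate minimiser with (14) at `C₁B₃δ`), (ii) K0's (R)-name ((8): minimisers are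
`B₃δ`-regular), (iii) the supply of an approximate minimiser AT LENGTH 1 ONLY — the supply token under the guard `Adm ∧ (k = 1)` (*«for k = 1 we do not have any solutions of the
variational problem yet, and then we take simply U₀ = V₀»*), (iv) the LIFT token (11)–(13), (v) truncation-stability of the guard.  Proof = print's: induction on `k`; at `k + 1 ≥ 2`
the lift supplies `(ε₀′, δ′, V₀)` for the truncated problem, the induction hypothesis a minimiser `U₀ = U_k(V₀)` there ((12)), (R) its regularity, the lift (13) = (14) at length `k+1`,
and the step token concludes. [cite: Balaban1985Variational, Thm 1 p.279, (11) p.279, (12)–(14) p.280, Prop. 2 p.281, (141)–(142) p.299] -/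
theorem variationalThm1EUSepTop7MG_of_step_of_reg_of_base_of_lift (hstep : VariationalThm1EUStepTop7MG F N Sup Adm C₁ B₃ a₀ a₁)
    (hR : VariationalThm1RegSepTop7MG F N Sup Adm B₃ a₀ a₁)
    (hbase : ApproxMinimiserExistsTop7MG F N Sup (fun ν M g K k s => Adm ν M g K k s ∧ k = 1) C₁ B₃ a₀ a₁)
    (hlift : VariationalThm1EULiftTop7MG F N Sup Adm C₁ B₃ a₀ a₁)
    (hAdm : ∀ ν M g K k (s : SeqOfRecord F ν M g K (k + 1)), 0 < k → Adm ν M g K (k + 1) s → Adm ν M g K k (truncSeq s)) :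
    VariationalThm1EUSepTop7MG F N Sup Adm B₃ a₀ a₁ := by
  intro ν M g K k
  induction k with
  | zero => intro s hk; exact absurd hk (lt_irrefl 0)
  | succ k ih =>
    intro s hk hsep hM₁ hadm ε₀ δ hnum hc hc' hε W h7
    rcases Nat.eq_zero_or_pos k with hk0 | hk0
    · -- length `1`: the supply token at length `1` gives `U₀` ((11): `U₀ = V₀`), the step token concludes
      subst hk0
      obtain ⟨U₀, hU₀⟩ := hbase ν M g K 1 s hk hsep hM₁ ⟨hadm, rfl⟩ ε₀ δ hnum hc hc' hε W h7
      exact hstep ν M g K 1 s hk hsep hM₁ hadm ε₀ δ hnum hc hc' hε W h7 U₀ hU₀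
    · -- length `k + 1 ≥ 2`: lift, induction hypothesis on the truncated problem, (R), step
      obtain ⟨ε₀', δ', V₀, hnum', hcm', hcm'', hε', h7', himp⟩ := hlift ν M g K k s hk0 hsep hM₁ hadm ε₀ δ hnum hc hc' hε W h7
      have hsep' : Sect2.SeqSeparated ν.M₁ (truncSeq s) := seqSeparated_truncSeq s hsep
      have hadm' : Adm ν M g K k (truncSeq s) := hAdm ν M g K k s hk0 hadm
      obtain ⟨⟨U₀, hU₀⟩, -⟩ := ih (truncSeq s) hk0 hsep' hM₁ hadm' ε₀' δ' hnum' hcm' hcm'' hε' V₀ h7'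
      have h8 := hR ν M g K k (truncSeq s) hsep' hM₁ hadm' ε₀' δ' hnum' hcm' hcm'' hε' V₀ h7' U₀ hU₀
      exact hstep ν M g K (k + 1) s hk hsep hM₁ hadm ε₀ δ hnum hc hc' hε W h7 U₀ (himp U₀ hU₀ h8)

/-- **★★★ `CoP` EDITION — [15] THEOREM 1 (E∕U) BY INDUCTION ON THE LENGTH, ON THE SUPPORT OF RECORD**: the (E∕U) name of record `VariationalThm1EUSepCoP7MG F N Adm B₃ a₀ a₁` (#10741,
the input of N12's junction of record v14ᴸ #10983) from the `CoP` step token, K0's `Node00.VariationalThm1RegSepCoP7MG`, the `CoP` supply token at length `1`, the `CoP` lift token and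
truncation-stability of the guard. [cite: Balaban1985Variational, Thm 1 p.279, (11)–(14) pp.279–280, Prop. 2 p.281; Balaban1988Convergent, (2.12) p.256] -/
theorem variationalThm1EUSepCoP7MG_of_step_of_reg_of_base_of_lift (hstep : VariationalThm1EUStepCoP7MG F N Adm C₁ B₃ a₀ a₁)
    (hR : VariationalThm1RegSepCoP7MG F N Adm B₃ a₀ a₁)
    (hbase : ApproxMinimiserExistsCoP7MG F N (fun ν M g K k s => Adm ν M g K k s ∧ k = 1) C₁ B₃ a₀ a₁)
    (hlift : VariationalThm1EULiftCoP7MG F N Adm C₁ B₃ a₀ a₁)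
    (hAdm : ∀ ν M g K k (s : SeqOfRecord F ν M g K (k + 1)), 0 < k → Adm ν M g K (k + 1) s → Adm ν M g K k (truncSeq s)) :
    VariationalThm1EUSepCoP7MG F N Adm B₃ a₀ a₁ :=
  variationalThm1EUSepTop7MG_of_step_of_reg_of_base_of_lift hstep hR hbase hlift hAdm

/-- **THE FLOOR-GUARD INSTANCE** (K0's `floorGuard F c`, truncation-stable for free): (E∕U) under the floor guard from the four tokens under the floor guard.
[cite: Balaban1985Variational, Thm 1 p.279, (11)–(14) pp.279–280; Balaban1985RegularSpaces, (1.3)–(1.6) p.77] -/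
theorem variationalThm1EUSepCoP7MG_floorGuard_of_step_of_reg_of_base_of_lift (c : ℕ) (hstep : VariationalThm1EUStepCoP7MG F N (floorGuard F c) C₁ B₃ a₀ a₁)
    (hR : VariationalThm1RegSepCoP7MG F N (floorGuard F c) B₃ a₀ a₁)
    (hbase : ApproxMinimiserExistsCoP7MG F N (fun ν M g K k s => floorGuard F c ν M g K k s ∧ k = 1) C₁ B₃ a₀ a₁)
    (hlift : VariationalThm1EULiftCoP7MG F N (floorGuard F c) C₁ B₃ a₀ a₁) :
    VariationalThm1EUSepCoP7MG F N (floorGuard F c) B₃ a₀ a₁ :=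
  variationalThm1EUSepCoP7MG_of_step_of_reg_of_base_of_lift hstep hR hbase hlift fun _ν _M _g _K _k s _ h => floorGuard_truncSeq c _ _ _ _ _ s h

end Induction

end Literature.MathematicalPhysics.QuantumFieldTheory.Balaban1983to89.B11Thm1ExistsUniqueInductionG

end
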